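import Mathlib
import HarnessLib
import Summits.NavierStokesRegularity.NavierStokesRegularity.Theorems.AxisTwistDoorAveragedConeLiouvilleCircleToolkit

/-!
# Route `AxisTwistDoor`, crux `AveragedConeLiouville` (stmt-NavierStokesRegularity-26889), line `lrt_shell`, stub (5)
# `stub_fluxDecay` — brick F3: LRT's DISC IDENTITY (eq. Gamma-30) from the circle-averaged swirl identity, and the
# ONE-SIDED SHELL INEQUALITY (eq. Gamma-34) on every circle where the velocity is bounded

Lei–Ren–Tian, arXiv:2501.08976, §4 p. 11.  For a profile `v` of the route's energy class:

* `gamma30_of_circleSwirl` — if `v` satisfies the planner's circle-averaged swirl identity `CircleSwirlEquation v`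
  (stub (1), `∂ₛΓ + v̄ᵣ∂ᵣΓ + v̄_z∂_zΓ = ∂ᵣ²Γ − r⁻¹∂ᵣΓ + ∂_z²Γ + ℛ` with `∂ᵣΓ = ∮ω₃ dl`), then with `∂_zΓ = −∮ω_r dl`
  (stub (2), landed) the θ-means cancel (`ℛ = −∮(v_rω₃ − ω_r v₃) dl − v̄_z ∮ω_r dl + v̄ᵣ ∮ω₃ dl`, linearity of the
  circle integrals) and `Γ` satisfies LRT's disc identity with EQUALITY:
  `∂ₛΓ − ∂_z²Γ − ∂ᵣ²Γ + r⁻¹∂ᵣΓ + ∮(v_r ω₃ − ω_r v₃) dl = 0`;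
* `gamma34_on_circle` — if moreover `ω₃ ≥ 0` (`SignE3`), the slack-free cone `∮|ω_h| dl ≤ K ∮ω₃ dl` holds on the circle
  `S(r,z)` at time `s`, and `|v(s)| ≤ B` on that circle, then (stub (2)'s shell inequality)
  `∂ₛΓ − ∂_z²Γ − ∂ᵣ²Γ + (r⁻¹ − B(1+K)) ∂ᵣΓ ≤ 0`, i.e. eq. Gamma-34 with the explicit radial drift, the form fed to the
  positivity-propagation step of stub (5).

Seat ns-atd-p1 (LEAD). WHAT THIS IS NOT: not a statement about Navier–Stokes regularity; two algebraic consequences of the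
registered stubs (1)–(2) for a STAGED door route. Lands `--supports` the crux item as a helper.
-/

noncomputable section

-- the summit and its single sub-problem share the name (CONVENTIONS §1), as in every Theorems file
set_option linter.dupNamespace false

namespace Summit.NavierStokesRegularity.NavierStokesRegularity.Theorems.AxisTwistDoorAveragedConeLiouvilleGamma34

open scoped InnerProductSpace
open Set Function MeasureTheory intervalIntegral
open Literature.Analysis
open Literature.Analysis.FluidPDE hiding eR
open Summit.NavierStokesRegularity.NavierStokesRegularity.Theorems.AxisTwistDoorAveragedConeLiouvilleDefs
open Summit.NavierStokesRegularity.NavierStokesRegularity.Theorems.AxisTwistDoorAveragedConeLiouvilleCylFrame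
open Summit.NavierStokesRegularity.NavierStokesRegularity.Theorems.AxisTwistDoorAveragedConeLiouvilleCircleToolkit
open Summit.NavierStokesRegularity.NavierStokesRegularity.Theorems.AveragedConeLiouville.CircleStokes
  (continuous_eR continuous_eT)

variable {C : ℝ} {v : ℝ → EuclideanSpace ℝ (Fin 3) → EuclideanSpace ℝ (Fin 3)}
  {π : ℝ → EuclideanSpace ℝ (Fin 3) → ℝ}
  {H : ℝ → EuclideanSpace ℝ (Fin 3) → EuclideanSpace ℝ (Fin 3) →L[ℝ] EuclideanSpace ℝ (Fin 3)}

/-! ### The θ-means cancel: `ℛ = −circleTerm − v̄_z ∮ω_r dl + v̄ᵣ ∮ω₃ dl` -/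

/-- The planner's fluctuation remainder in terms of LRT's circle term and the two vorticity line integrals:
`ℛ(r,z,s) = −∮(v_r ω₃ − ω_r v₃) dl − v̄_z(r,z,s) ∮ω_r dl + v̄ᵣ(r,z,s) ∮ω₃ dl` (linearity of the circle integrals;
the integrands are continuous for a class profile). -/
theorem remainder_eq (h : InClass C v π H) {s : ℝ} (hs : s < 0) (r z : ℝ) :
    remainder v r z s = -circleTerm v r z s - meanZ v r z s * radVortCirc v r z s
      + meanR v r z s * vortCirc v r z s := by
  have hvc : Continuous fun θ => v s (cylPt r θ z) :=
    (contDiff_slice h hs).continuous.comp (continuous_cylPt_θ r z)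
  have hωc : Continuous fun θ => curl (v s) (cylPt r θ z) :=
    (continuous_curl_slice h hs).comp (continuous_cylPt_θ r z)
  -- the pieces of the integrand
  have hA : Continuous fun θ => ⟪v s (cylPt r θ z), e3⟫_ℝ * ⟪curl (v s) (cylPt r θ z), eR θ⟫_ℝ * r :=
    ((hvc.inner continuous_const).mul (hωc.inner continuous_eR)).mul continuous_const
  have hB : Continuous fun θ => ⟪v s (cylPt r θ z), eR θ⟫_ℝ * ⟪curl (v s) (cylPt r θ z), e3⟫_ℝ * r :=
    ((hvc.inner continuous_eR).mul (hωc.inner continuous_const)).mul continuous_const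
  have hR : Continuous fun θ => ⟪curl (v s) (cylPt r θ z), eR θ⟫_ℝ * r :=
    (hωc.inner continuous_eR).mul continuous_const
  have hZ : Continuous fun θ => ⟪curl (v s) (cylPt r θ z), e3⟫_ℝ * r :=
    (hωc.inner continuous_const).mul continuous_const
  -- pointwise expansion of the remainder integrand
  have hpt : (fun θ => ((⟪v s (cylPt r θ z), e3⟫_ℝ - meanZ v r z s) * ⟪curl (v s) (cylPt r θ z), eR θ⟫_ℝ
        - (⟪v s (cylPt r θ z), eR θ⟫_ℝ - meanR v r z s) * ⟪curl (v s) (cylPt r θ z), e3⟫_ℝ) * r) =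
      fun θ => ((⟪v s (cylPt r θ z), e3⟫_ℝ * ⟪curl (v s) (cylPt r θ z), eR θ⟫_ℝ * r
          - ⟪v s (cylPt r θ z), eR θ⟫_ℝ * ⟪curl (v s) (cylPt r θ z), e3⟫_ℝ * r)
        - meanZ v r z s * (⟪curl (v s) (cylPt r θ z), eR θ⟫_ℝ * r))
        + meanR v r z s * (⟪curl (v s) (cylPt r θ z), e3⟫_ℝ * r) := by
    funext θ; ring
  have hcirc : (fun θ => ⟪v s (cylPt r θ z), e3⟫_ℝ * ⟪curl (v s) (cylPt r θ z), eR θ⟫_ℝ * r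
        - ⟪v s (cylPt r θ z), eR θ⟫_ℝ * ⟪curl (v s) (cylPt r θ z), e3⟫_ℝ * r) =
      fun θ => -((⟪v s (cylPt r θ z), eR θ⟫_ℝ * ⟪curl (v s) (cylPt r θ z), e3⟫_ℝ
        - ⟪curl (v s) (cylPt r θ z), eR θ⟫_ℝ * ⟪v s (cylPt r θ z), e3⟫_ℝ) * r) := by
    funext θ; ring
  have i1 : IntervalIntegrable (fun θ => (⟪v s (cylPt r θ z), e3⟫_ℝ * ⟪curl (v s) (cylPt r θ z), eR θ⟫_ℝ * r
        - ⟪v s (cylPt r θ z), eR θ⟫_ℝ * ⟪curl (v s) (cylPt r θ z), e3⟫_ℝ * r)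
        - meanZ v r z s * (⟪curl (v s) (cylPt r θ z), eR θ⟫_ℝ * r)) volume 0 (2 * Real.pi) :=
    ((hA.sub hB).sub (continuous_const.mul hR)).intervalIntegrable _ _
  have i2 : IntervalIntegrable (fun θ => meanR v r z s * (⟪curl (v s) (cylPt r θ z), e3⟫_ℝ * r))
      volume 0 (2 * Real.pi) := (continuous_const.mul hZ).intervalIntegrable _ _
  have i3 : IntervalIntegrable (fun θ => ⟪v s (cylPt r θ z), e3⟫_ℝ * ⟪curl (v s) (cylPt r θ z), eR θ⟫_ℝ * r
        - ⟪v s (cylPt r θ z), eR θ⟫_ℝ * ⟪curl (v s) (cylPt r θ z), e3⟫_ℝ * r) volume 0 (2 * Real.pi) :=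
    (hA.sub hB).intervalIntegrable _ _
  have i4 : IntervalIntegrable (fun θ => meanZ v r z s * (⟪curl (v s) (cylPt r θ z), eR θ⟫_ℝ * r))
      volume 0 (2 * Real.pi) := (continuous_const.mul hR).intervalIntegrable _ _
  unfold remainder circleTerm radVortCirc vortCirc
  rw [hpt, intervalIntegral.integral_add i1 i2, intervalIntegral.integral_sub i3 i4,
    intervalIntegral.integral_const_mul, intervalIntegral.integral_const_mul, hcirc, intervalIntegral.integral_neg]

/-! ### Gamma-30 from the circle-averaged swirl identity -/

/-- **LRT's disc identity (eq. Gamma-30) with equality** for a class profile satisfying the planner's circle-averaged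
swirl identity: `∂ₛΓ − ∂_z²Γ − ∂ᵣ²Γ + r⁻¹∂ᵣΓ + ∮(v_r ω₃ − ω_r v₃) dl = 0` at every `s < 0`, `r > 0`, `z`. -/
theorem gamma30_of_circleSwirl (h : InClass C v π H) (hcse : CircleSwirlEquation v) {s r : ℝ} (hs : s < 0)
    (hr : 0 < r) (z : ℝ) :
    deriv (fun s' => circ v r z s') s
      - deriv (fun z' => deriv (fun z'' => circ v r z'' s) z') z
      - deriv (fun r' => deriv (fun r'' => circ v r'' z s) r') r
      + r⁻¹ * deriv (fun r' => circ v r' z s) r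
      + circleTerm v r z s = 0 := by
  obtain ⟨h1, h2⟩ := hcse s hs r hr z
  have h3 : deriv (fun z' => circ v r z' s) z = -radVortCirc v r z s := (hasDerivAt_circ_z h hs r z).deriv
  have h4 := remainder_eq h hs r z
  rw [h1, h3, h4] at h2
  rw [h1]
  linarith

/-! ### Gamma-34 on a circle where the velocity is bounded -/

/-- **The one-sided shell inequality (eq. Gamma-34) on a circle.** For a class profile with `ω₃ ≥ 0` satisfying the
circle-averaged swirl identity, on a circle `S(r,z)` at time `s < 0` where the slack-free cone
`∮|ω_h| dl ≤ K ∮ω₃ dl` holds and `|v(s)| ≤ B`: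
`∂ₛΓ − ∂_z²Γ − ∂ᵣ²Γ + (r⁻¹ − B(1+K)) ∂ᵣΓ ≤ 0`. -/
theorem gamma34_on_circle (h : InClass C v π H) (hsign : SignE3 v) (hcse : CircleSwirlEquation v)
    {s r z K B : ℝ} (hs : s < 0) (hr : 0 < r)
    (hcone : tiltCirc v r z s ≤ K * vortCirc v r z s) (hB : ∀ θ : ℝ, ‖v s (cylPt r θ z)‖ ≤ B) :
    deriv (fun s' => circ v r z s') s
      - deriv (fun z' => deriv (fun z'' => circ v r z'' s) z') z
      - deriv (fun r' => deriv (fun r'' => circ v r'' z s) r') r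
      + (r⁻¹ - B * (1 + K)) * deriv (fun r' => circ v r' z s) r ≤ 0 := by
  have h30 := gamma30_of_circleSwirl h hcse hs hr z
  obtain ⟨h1, -⟩ := hcse s hs r hr z
  obtain ⟨hct, -⟩ := (stub_circleToolkit C v π H h).2.2.2 hsign s r z B hs hr hB
  have hB0 : 0 ≤ B := (norm_nonneg _).trans (hB 0)
  -- `|circleTerm| ≤ B (∮ω₃ + ∮|ω_h|) ≤ B (1 + K) ∮ω₃`
  have hle : |circleTerm v r z s| ≤ B * (1 + K) * vortCirc v r z s := by
    refine hct.trans ?_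
    have : vortCirc v r z s + tiltCirc v r z s ≤ (1 + K) * vortCirc v r z s := by linarith
    calc B * (vortCirc v r z s + tiltCirc v r z s) ≤ B * ((1 + K) * vortCirc v r z s) :=
          mul_le_mul_of_nonneg_left this hB0
      _ = B * (1 + K) * vortCirc v r z s := by ring
  have hlow : -(B * (1 + K) * vortCirc v r z s) ≤ circleTerm v r z s := by
    have := neg_abs_le (circleTerm v r z s)
    linarith
  rw [h1]
  rw [h1] at h30
  nlinarith [hlow, h30]

end Summit.NavierStokesRegularity.NavierStokesRegularity.Theorems.AxisTwistDoorAveragedConeLiouvilleGamma34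

end
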